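/-
Copyright (c) 2026 the pub-hodgecm-mathlib formalisation cell (harness21).  Prover seat hodgecm-mathlib-LH4-p07 (g12): Track B «K2-LIT» valve hand,
hLiu418 = stmt-HodgeConjecture-24832; (σ-A) road desk K2Liu-p25 (g3) WORD #5 (2) ∕ #9 (1) «(an-1) the null-cone Radon measure as the weak limit of ★ p864232 §1's ball
averages»; LEAD F0P6-plan (g15) RULING M-160f.  FILE A of (an-1): the functional level.
-/
import Summits.HodgeConjecture.HodgeConjecture.Theorems.K2LiuRankOneStageIntegralsAtHalf   -- ★ p864232 [A3] FILE 1 (this seat): `tendsto_ballAverage_nullCone`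
import Literature.NumberTheory.Automorphic.LocalPiSchwartzBruhatFourier                  -- ★ boxes `piPrimePowBall`, `exists_eq_zero_of_notMem_piPrimePowBall`
import Literature.NumberTheory.Automorphic.SchwartzPiHomothety                            -- ★ `smul_mem_piPrimePowBall_iff`
import HarnessLib

/-!
# Crux `HLiu418`, road `K2_Liu`, (σ-A) mini-road, brick (an-1) FILE A: THE NULL-CONE FUNCTIONAL `Φ ↦ Re ∫_β ∫_x Φ(x)·ψ(β·Q(x)) dμ^ι dμ` ON REAL SCHWARTZ–BRUHAT
# FUNCTIONS — real limit of the ball averages, additivity, homogeneity, positivity, vanishing off the cone, and the scaling law at the vertex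

Cell `hodgecm-mathlib`, crux item hLiu418 = `stmt-HodgeConjecture-24832`; squad K2 ∕ K2Liu (L1); prover LH4-p07 (g12).  THEOREMS ONLY (no `def`, no `instance`, no
`notation`, no named-fact hypothesis, no `sorry`, default heartbeats); lane `--supports stmt-HodgeConjecture-24832 --as helper` (count-neutral helper; closes no socket).

SETTING.  `K` a non-archimedean local field with `2` invertible, `μ` a Haar measure on `K`, `ψ` of conductor exponent `d`, `‖2‖ = q^{−v₂}`, `Q` a quadratic form on
`K^ι` with non-degenerate polar form, `3 ≤ card ι`.  ★ p864232 `tendsto_ballAverage_nullCone`: for `Ψ ∈ 𝒮(K^ι)` the ball averages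
`selfDualConst μ d · μ(𝔭^k)⁻¹ · ∫ Ψ·1_{𝔭^k}(Q)` converge to `∫_β ∫_x Ψ(x)·ψ(β Q x) dμ^ι dμ`.  This file reads that limit as a POSITIVE LINEAR FUNCTIONAL on the REAL
Schwartz–Bruhat functions — the input of the sandwich road (★ `Literature/MeasureTheory/RieszRepresentation/PositiveFunctionalExtension`) taken in FILE B
`K2LiuNullConeRadonMeasure` to produce the null-cone measure `σ` with `∫ Ψ dσ = ∫_β ∫_x Ψ ψ(βQ)`, `σ{Q ≠ 0} = 0`, `σ{0} = 0`.
* §1 `tendsto_ballAverageReal_nullCone` — for REAL `Φ` with `(Φ : ℂ) ∈ 𝒮`: the REAL ball averages converge to `Re ∫∫` and `Im ∫∫ = 0`.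
* §2 `nullConeIntegral_add` ∕ `nullConeIntegral_smul` ∕ `nullConeValue_nonneg` ∕ `abs_nullConeValue_le` — additivity, homogeneity, positivity, monotonicity of `Φ ↦ (Re) ∫∫`
  (integrability of the Gauss transform in `β` is ★ p864232 §1; in `x` it is the Schwartz–Bruhat function times a unimodular continuous phase, §0).
* §3 `nullConeIntegral_eq_zero_of_forall_ne_zero` — if `Q ≠ 0` on `tsupport Ψ` then `∫∫ = 0` (the ball averages vanish as soon as `𝔭^k` misses the compact `Q(tsupport Ψ)`).
* §4 `nullConeIntegral_indicator_piPrimePowBall_succ` — THE SCALING LAW AT THE VERTEX: `∫∫(1_{(𝔭^{n+1})^ι}) = (q^{−card ι}·q²) · ∫∫(1_{(𝔭^n)^ι})` (substitute `x = ϖ·u`, then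
  `β = ϖ^{−2}·β′`), whence `σ((𝔭^n)^ι) → 0` geometrically in FILE B (`card ι ≥ 3`).
* §5 `exists_isLocallyConstant_approx` — a test function `g ∈ C_c(K^ι, ℝ)` vanishing off a box is uniformly approximated by LOCALLY CONSTANT real functions vanishing off the
  same box (one-factor port of ★ `SplitPlace.exists_locallyConstant_approx`) — the Darboux sandwich of FILE B.
[Weil1965, Chap. I n° 2 Lemme 3; Chap. III n° 36 Prop. 6] [KudlaRallis1994, §5 (5.3)–(5.6)] [Igusa1978 is NOT cited: nothing here depends on it].
HONEST LABEL.  `HC_CM` is proved only modulo the 7 printed citations (2 remaining named inputs: hLiu418 = `stmt-HodgeConjecture-24832`,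
h413 = `stmt-HodgeConjecture-24833`) until rung 0 closes; count-neutral helper, closes no socket; `hcone`∕[A4-an] stay BY VALUE (R2) until (an-1)–(an-3) are ★.

## References
* [Weil1965] A. Weil, *Sur la formule de Siegel dans la théorie des groupes classiques*, Acta Math. 113 (1965), Chap. I n° 2 Lemme 3 (p. 7); Chap. III n° 36 Prop. 6 (p. 54).
* [KudlaRallis1994] S. Kudla, S. Rallis, Ann. of Math. 140 (1994), §5 (5.3)–(5.6) (the regularised orbital integral on the null cone).
* [Rudin1987] W. Rudin, *Real and Complex Analysis* (1987), Thm. 2.14.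
-/

set_option autoImplicit false
set_option linter.dupNamespace false -- the mandated namespace repeats `HodgeConjecture.HodgeConjecture`

noncomputable section

namespace Summit.HodgeConjecture.HodgeConjecture.Cruxes.HLiu418.K2LiuNullConeFunctional

open MeasureTheory Filter Topology Set Matrix CompactlySupported
open scoped NNReal Pointwise
open Literature.NumberTheory.GaloisRepresentations.IsNonarchimedeanLocalField
open Literature.NumberTheory.Automorphic Literature.NumberTheory.Weil1964 Literature.NumberTheory.Weil1965
open Summit.HodgeConjecture.HodgeConjecture.Cruxes.HLiu418.K2LiuRankOneStageIntegralsAtHalf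

variable {K : Type*} [Field K] [ValuativeRel K] [TopologicalSpace K] [IsNonarchimedeanLocalField K]
variable {ι : Type*} [Fintype ι] [MeasurableSpace K] [BorelSpace K] (μ : Measure K) [μ.IsAddHaarMeasure] {ψ : AddChar K Circle}

/-! ## §0 Two small facts: quadratic forms on `K^ι` are continuous; the Schwartz–Bruhat × phase integrand is integrable -/

omit [ValuativeRel K] [IsNonarchimedeanLocalField K] [MeasurableSpace K] [BorelSpace K] in
/-- a quadratic form on `K^ι` with non-degenerate polar form is continuous (it is `Σ cᵢ (e x)ᵢ²` for a linear automorphism `e`, ★ `exists_linearEquiv_eq_sum_sq`).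
[cite: Weil1964, Chap. II n° 25, p. 173] -/
theorem continuous_quadraticForm [IsTopologicalRing K] [Invertible (2 : K)] (Q : QuadraticForm K (ι → K))
    (hQ : (QuadraticMap.associated (R := K) Q).SeparatingLeft) : Continuous (Q : (ι → K) → K) := by
  obtain ⟨e, c, -, hQe⟩ := exists_linearEquiv_eq_sum_sq Q hQ
  have he : Continuous (e : (ι → K) → (ι → K)) := (e : (ι → K) →ₗ[K] (ι → K)).continuous_on_pi
  have h : (Q : (ι → K) → K) = fun x => ∑ i, c i * (e x) i ^ 2 := funext hQe
  rw [h]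
  exact continuous_finsetSum _ fun i _ => continuous_const.mul (((continuous_apply i).comp he).pow 2)

/-- for `Ψ ∈ 𝒮(K^ι)` and every `β`, `x ↦ Ψ(x)·ψ(β·Q(x))` is integrable (Schwartz–Bruhat times a unimodular continuous phase).
[cite: Weil1965, Chap. I n° 2, p. 8] -/
theorem integrable_mul_addChar_quadraticForm [Invertible (2 : K)] {d : ℤ} (hd : ψ.HasConductorExp d) (Q : QuadraticForm K (ι → K))
    (hQ : (QuadraticMap.associated (R := K) Q).SeparatingLeft) {Ψ : (ι → K) → ℂ} (hΨ : Ψ ∈ SchwartzBruhat (ι → K)) (β : K) :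
    Integrable (fun x => Ψ x * ((ψ (β * Q x) : Circle) : ℂ)) (Measure.pi fun _ : ι => μ) := by
  haveI : SecondCountableTopology K := secondCountableTopology_localField K
  have hψ : Continuous ψ := continuous_of_hasConductorExp hd
  have hc : Continuous fun x : ι → K => ((ψ (β * Q x) : Circle) : ℂ) :=
    continuous_subtype_val.comp (hψ.comp (continuous_const.mul (continuous_quadraticForm Q hQ)))
  refine (integrable_of_mem_schwartzBruhat_pi μ hψ hΨ).mul_bdd hc.aestronglyMeasurable (c := 1) (Eventually.of_forall fun x => ?_)
  rw [Circle.norm_coe]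

/-! ## §1 Real Schwartz–Bruhat functions: the real ball averages converge to `Re ∫∫`, and `Im ∫∫ = 0` -/

/-- **REAL BALL AVERAGES.**  For a REAL `Φ` whose complexification is Schwartz–Bruhat, the real ball averages `selfDualConst μ d · μ(𝔭^k)⁻¹ · ∫ Φ·1_{𝔭^k}(Q) dμ^ι` converge
to `Re ∫_β ∫_x Φ(x)·ψ(β Q x) dμ^ι dμ`, and that double integral is REAL. [cite: Weil1965, Chap. III n° 36 Prop. 6, p. 54] -/
theorem tendsto_ballAverageReal_nullCone [Invertible (2 : K)] {d : ℤ} (hd : ψ.HasConductorExp d) {v₂ : ℤ}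
    (h2 : normAbs K (2 : K) = (residueFieldCard K : ℝ≥0)⁻¹ ^ v₂) (Q : QuadraticForm K (ι → K))
    (hQ : (QuadraticMap.associated (R := K) Q).SeparatingLeft) (hr : 3 ≤ Fintype.card ι)
    {Φ : (ι → K) → ℝ} (hΦ : (fun x => (Φ x : ℂ)) ∈ SchwartzBruhat (ι → K)) :
    Tendsto (fun k : ℕ => selfDualConst μ d * (μ.real (primePowBall K k))⁻¹ *
        ∫ x, Φ x * (primePowBall K (k : ℤ)).indicator (fun _ => (1 : ℝ)) (Q x) ∂(Measure.pi fun _ : ι => μ)) atTop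
      (𝓝 ((∫ β, ∫ x, (Φ x : ℂ) * ((ψ (β * Q x) : Circle) : ℂ) ∂(Measure.pi fun _ : ι => μ) ∂μ).re)) ∧
    (∫ β, ∫ x, (Φ x : ℂ) * ((ψ (β * Q x) : Circle) : ℂ) ∂(Measure.pi fun _ : ι => μ) ∂μ).im = 0 := by
  obtain ⟨-, hlim⟩ := tendsto_ballAverage_nullCone μ hd h2 Q hQ hΦ hr
  -- the complex ball averages are the complexified real ones
  have hcast : ∀ k : ℕ, (selfDualConst μ d : ℂ) * (μ.real (primePowBall K k) : ℂ)⁻¹ *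
        ∫ x, (Φ x : ℂ) * (primePowBall K (k : ℤ)).indicator (fun _ => (1 : ℂ)) (Q x) ∂(Measure.pi fun _ : ι => μ) =
      ((selfDualConst μ d * (μ.real (primePowBall K k))⁻¹ *
        ∫ x, Φ x * (primePowBall K (k : ℤ)).indicator (fun _ => (1 : ℝ)) (Q x) ∂(Measure.pi fun _ : ι => μ) : ℝ) : ℂ) := by
    intro k
    rw [Complex.ofReal_mul, Complex.ofReal_mul, Complex.ofReal_inv, ← integral_complex_ofReal]
    congr 1
    refine integral_congr_ae (Eventually.of_forall fun x => ?_)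
    by_cases hx : Q x ∈ primePowBall K (k : ℤ)
    · simp only [Set.indicator_of_mem hx, mul_one]
    · simp only [Set.indicator_of_notMem hx, mul_zero, Complex.ofReal_zero]
  have hlim' : Tendsto (fun k : ℕ => ((selfDualConst μ d * (μ.real (primePowBall K k))⁻¹ *
      ∫ x, Φ x * (primePowBall K (k : ℤ)).indicator (fun _ => (1 : ℝ)) (Q x) ∂(Measure.pi fun _ : ι => μ) : ℝ) : ℂ)) atTop
      (𝓝 (∫ β, ∫ x, (Φ x : ℂ) * ((ψ (β * Q x) : Circle) : ℂ) ∂(Measure.pi fun _ : ι => μ) ∂μ)) :=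
    hlim.congr hcast
  refine ⟨?_, ?_⟩
  · have h := (Complex.continuous_re.tendsto _).comp hlim'
    refine h.congr fun k => ?_
    simp only [Function.comp_apply, Complex.ofReal_re]
  · have h := (Complex.continuous_im.tendsto _).comp hlim'
    have h0 : Tendsto (fun _ : ℕ => (0 : ℝ)) atTop (𝓝 (∫ β, ∫ x, (Φ x : ℂ) * ((ψ (β * Q x) : Circle) : ℂ) ∂(Measure.pi fun _ : ι => μ) ∂μ).im) :=
      h.congr fun k => by simp only [Function.comp_apply, Complex.ofReal_im]
    exact (tendsto_nhds_unique h0 tendsto_const_nhds)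

/-! ## §2 The null-cone value `Φ ↦ Re ∫∫` is additive, homogeneous, positive and monotone on real Schwartz–Bruhat functions -/

/-- **ADDITIVITY** of `Φ ↦ ∫_β ∫_x Φ ψ(βQ)` on Schwartz–Bruhat functions (inner `integral_add` by §0, outer by ★ p864232 §1's integrability).
[cite: Weil1965, Chap. I n° 2 Lemme 3, p. 7] -/
theorem nullConeIntegral_add [Invertible (2 : K)] {d : ℤ} (hd : ψ.HasConductorExp d) {v₂ : ℤ}
    (h2 : normAbs K (2 : K) = (residueFieldCard K : ℝ≥0)⁻¹ ^ v₂) (Q : QuadraticForm K (ι → K))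
    (hQ : (QuadraticMap.associated (R := K) Q).SeparatingLeft) (hr : 3 ≤ Fintype.card ι)
    {Ψ₁ Ψ₂ : (ι → K) → ℂ} (hΨ₁ : Ψ₁ ∈ SchwartzBruhat (ι → K)) (hΨ₂ : Ψ₂ ∈ SchwartzBruhat (ι → K)) :
    ∫ β, ∫ x, (Ψ₁ x + Ψ₂ x) * ((ψ (β * Q x) : Circle) : ℂ) ∂(Measure.pi fun _ : ι => μ) ∂μ =
      (∫ β, ∫ x, Ψ₁ x * ((ψ (β * Q x) : Circle) : ℂ) ∂(Measure.pi fun _ : ι => μ) ∂μ) +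
        ∫ β, ∫ x, Ψ₂ x * ((ψ (β * Q x) : Circle) : ℂ) ∂(Measure.pi fun _ : ι => μ) ∂μ := by
  obtain ⟨hint₁, -⟩ := tendsto_ballAverage_nullCone μ hd h2 Q hQ hΨ₁ hr
  obtain ⟨hint₂, -⟩ := tendsto_ballAverage_nullCone μ hd h2 Q hQ hΨ₂ hr
  rw [← integral_add hint₁ hint₂]
  refine integral_congr_ae (Eventually.of_forall fun β => ?_)
  dsimp only
  rw [← integral_add (integrable_mul_addChar_quadraticForm μ hd Q hQ hΨ₁ β) (integrable_mul_addChar_quadraticForm μ hd Q hQ hΨ₂ β)]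
  refine integral_congr_ae (Eventually.of_forall fun x => ?_)
  simp only [add_mul]

omit [ValuativeRel K] [TopologicalSpace K] [IsNonarchimedeanLocalField K] [BorelSpace K] [μ.IsAddHaarMeasure] in
/-- **HOMOGENEITY** of `Φ ↦ ∫_β ∫_x Φ ψ(βQ)` (no integrability needed). [cite: Weil1965, Chap. I n° 2 Lemme 3, p. 7] -/
theorem nullConeIntegral_smul (Q : QuadraticForm K (ι → K)) (a : ℂ) (Ψ : (ι → K) → ℂ) :
    ∫ β, ∫ x, (a * Ψ x) * ((ψ (β * Q x) : Circle) : ℂ) ∂(Measure.pi fun _ : ι => μ) ∂μ =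
      a * ∫ β, ∫ x, Ψ x * ((ψ (β * Q x) : Circle) : ℂ) ∂(Measure.pi fun _ : ι => μ) ∂μ := by
  rw [← integral_const_mul]
  refine integral_congr_ae (Eventually.of_forall fun β => ?_)
  dsimp only
  rw [← integral_const_mul]
  refine integral_congr_ae (Eventually.of_forall fun x => ?_)
  simp only [mul_assoc]

/-- **POSITIVITY**: for a real `Φ ≥ 0` with Schwartz–Bruhat complexification, `0 ≤ Re ∫_β ∫_x Φ ψ(βQ)` (a limit of non-negative ball averages).
[cite: Weil1965, Chap. I n° 2 Lemme 3, p. 7] -/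
theorem nullConeValue_nonneg [Invertible (2 : K)] {d : ℤ} (hd : ψ.HasConductorExp d) {v₂ : ℤ}
    (h2 : normAbs K (2 : K) = (residueFieldCard K : ℝ≥0)⁻¹ ^ v₂) (Q : QuadraticForm K (ι → K))
    (hQ : (QuadraticMap.associated (R := K) Q).SeparatingLeft) (hr : 3 ≤ Fintype.card ι)
    {Φ : (ι → K) → ℝ} (hΦ : (fun x => (Φ x : ℂ)) ∈ SchwartzBruhat (ι → K)) (hΦ0 : ∀ x, 0 ≤ Φ x) :
    0 ≤ (∫ β, ∫ x, (Φ x : ℂ) * ((ψ (β * Q x) : Circle) : ℂ) ∂(Measure.pi fun _ : ι => μ) ∂μ).re := by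
  obtain ⟨hlim, -⟩ := tendsto_ballAverageReal_nullCone μ hd h2 Q hQ hr hΦ
  refine ge_of_tendsto' hlim fun k => ?_
  refine mul_nonneg (mul_nonneg (selfDualConst_pos μ).le (inv_nonneg.2 measureReal_nonneg)) (integral_nonneg fun x => ?_)
  exact mul_nonneg (hΦ0 x) (Set.indicator_nonneg (fun _ _ => zero_le_one) _)

/-- **MONOTONICITY IN ABSOLUTE VALUE**: `|Re ∫∫ Φ| ≤ Re ∫∫ Θ` whenever `|Φ| ≤ Θ` pointwise (both real Schwartz–Bruhat). [cite: Weil1965, Chap. I n° 2 Lemme 3, p. 7] -/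
theorem abs_nullConeValue_le [Invertible (2 : K)] {d : ℤ} (hd : ψ.HasConductorExp d) {v₂ : ℤ}
    (h2 : normAbs K (2 : K) = (residueFieldCard K : ℝ≥0)⁻¹ ^ v₂) (Q : QuadraticForm K (ι → K))
    (hQ : (QuadraticMap.associated (R := K) Q).SeparatingLeft) (hr : 3 ≤ Fintype.card ι)
    {Φ Θ : (ι → K) → ℝ} (hΦ : (fun x => (Φ x : ℂ)) ∈ SchwartzBruhat (ι → K)) (hΘ : (fun x => (Θ x : ℂ)) ∈ SchwartzBruhat (ι → K))
    (hle : ∀ x, |Φ x| ≤ Θ x) :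
    |(∫ β, ∫ x, (Φ x : ℂ) * ((ψ (β * Q x) : Circle) : ℂ) ∂(Measure.pi fun _ : ι => μ) ∂μ).re| ≤
      (∫ β, ∫ x, (Θ x : ℂ) * ((ψ (β * Q x) : Circle) : ℂ) ∂(Measure.pi fun _ : ι => μ) ∂μ).re := by
  -- `Θ - Φ ≥ 0` and `Θ + Φ ≥ 0` are real Schwartz–Bruhat
  have hΘΦ : ∀ x, 0 ≤ Θ x - Φ x := fun x => by linarith [hle x, le_abs_self (Φ x)]
  have hΘΦ' : ∀ x, 0 ≤ Θ x + Φ x := fun x => by linarith [hle x, neg_abs_le (Φ x)]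
  have hm₁ : (fun x => ((Θ x - Φ x : ℝ) : ℂ)) ∈ SchwartzBruhat (ι → K) := by
    have e : (fun x => ((Θ x - Φ x : ℝ) : ℂ)) = (fun x => (Θ x : ℂ)) - fun x => (Φ x : ℂ) := by
      funext x; simp only [Pi.sub_apply, Complex.ofReal_sub]
    rw [e]; exact sub_mem hΘ hΦ
  have hm₂ : (fun x => ((Θ x + Φ x : ℝ) : ℂ)) ∈ SchwartzBruhat (ι → K) := by
    have e : (fun x => ((Θ x + Φ x : ℝ) : ℂ)) = (fun x => (Θ x : ℂ)) + fun x => (Φ x : ℂ) := by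
      funext x; simp only [Pi.add_apply, Complex.ofReal_add]
    rw [e]; exact add_mem hΘ hΦ
  have h₁ := nullConeValue_nonneg μ hd h2 Q hQ hr hm₁ hΘΦ
  have h₂ := nullConeValue_nonneg μ hd h2 Q hQ hr hm₂ hΘΦ'
  -- the double integrals of `Θ ∓ Φ` split
  have e₁ : ∫ β, ∫ x, ((Θ x - Φ x : ℝ) : ℂ) * ((ψ (β * Q x) : Circle) : ℂ) ∂(Measure.pi fun _ : ι => μ) ∂μ =
      (∫ β, ∫ x, (Θ x : ℂ) * ((ψ (β * Q x) : Circle) : ℂ) ∂(Measure.pi fun _ : ι => μ) ∂μ) -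
        ∫ β, ∫ x, (Φ x : ℂ) * ((ψ (β * Q x) : Circle) : ℂ) ∂(Measure.pi fun _ : ι => μ) ∂μ := by
    rw [eq_sub_iff_add_eq, ← nullConeIntegral_add μ hd h2 Q hQ hr hm₁ hΦ]
    refine integral_congr_ae (Eventually.of_forall fun β => ?_)
    dsimp only
    refine integral_congr_ae (Eventually.of_forall fun x => ?_)
    simp only [Complex.ofReal_sub, sub_add_cancel]
  have e₂ : ∫ β, ∫ x, ((Θ x + Φ x : ℝ) : ℂ) * ((ψ (β * Q x) : Circle) : ℂ) ∂(Measure.pi fun _ : ι => μ) ∂μ =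
      (∫ β, ∫ x, (Θ x : ℂ) * ((ψ (β * Q x) : Circle) : ℂ) ∂(Measure.pi fun _ : ι => μ) ∂μ) +
        ∫ β, ∫ x, (Φ x : ℂ) * ((ψ (β * Q x) : Circle) : ℂ) ∂(Measure.pi fun _ : ι => μ) ∂μ := by
    rw [← nullConeIntegral_add μ hd h2 Q hQ hr hΘ hΦ]
    refine integral_congr_ae (Eventually.of_forall fun β => ?_)
    dsimp only
    refine integral_congr_ae (Eventually.of_forall fun x => ?_)
    simp only [Complex.ofReal_add]
  rw [e₁, Complex.sub_re] at h₁
  rw [e₂, Complex.add_re] at h₂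
  exact abs_le.2 ⟨by linarith, by linarith⟩

/-! ## §3 Vanishing off the cone -/

/-- **THE NULL-CONE VALUE SEES ONLY THE CONE**: if `Q ≠ 0` on the (compact) support of `Ψ ∈ 𝒮(K^ι)` then `∫_β ∫_x Ψ(x)·ψ(β Q x) dμ^ι dμ = 0` — the compact set
`Q(tsupport Ψ)` misses `0`, so some ball `𝔭^N` misses it and every ball average with `k ≥ N` vanishes. [cite: Weil1965, Chap. I n° 2 Lemme 3, p. 7] -/
theorem nullConeIntegral_eq_zero_of_forall_ne_zero [Invertible (2 : K)] {d : ℤ} (hd : ψ.HasConductorExp d) {v₂ : ℤ}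
    (h2 : normAbs K (2 : K) = (residueFieldCard K : ℝ≥0)⁻¹ ^ v₂) (Q : QuadraticForm K (ι → K))
    (hQ : (QuadraticMap.associated (R := K) Q).SeparatingLeft) (hr : 3 ≤ Fintype.card ι)
    {Ψ : (ι → K) → ℂ} (hΨ : Ψ ∈ SchwartzBruhat (ι → K)) (hne : ∀ x ∈ tsupport Ψ, Q x ≠ 0) :
    ∫ β, ∫ x, Ψ x * ((ψ (β * Q x) : Circle) : ℂ) ∂(Measure.pi fun _ : ι => μ) ∂μ = 0 := by
  obtain ⟨-, hlim⟩ := tendsto_ballAverage_nullCone μ hd h2 Q hQ hΨ hr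
  -- a ball `𝔭^N` missing the compact `Q(tsupport Ψ)`
  have hK : IsCompact (Q '' tsupport Ψ) := hΨ.2.image (continuous_quadraticForm Q hQ)
  have h0 : (0 : K) ∉ Q '' tsupport Ψ := by
    rintro ⟨x, hx, hx0⟩
    exact hne x hx hx0
  haveI : T2Space K := (Literature.NumberTheory.GaloisRepresentations.IsNonarchimedeanLocalField.isLocalField K).toT2Space
  obtain ⟨N, hN⟩ := exists_primePowBall_subset_of_mem_nhds_zero (hK.isClosed.isOpen_compl.mem_nhds h0)
  -- the ball averages vanish from `N` on
  have hzero : ∀ k : ℕ, N ≤ k → (selfDualConst μ d : ℂ) * (μ.real (primePowBall K k) : ℂ)⁻¹ *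
      ∫ x, Ψ x * (primePowBall K (k : ℤ)).indicator (fun _ => (1 : ℂ)) (Q x) ∂(Measure.pi fun _ : ι => μ) = 0 := by
    intro k hk
    have hint : ∫ x, Ψ x * (primePowBall K (k : ℤ)).indicator (fun _ => (1 : ℂ)) (Q x) ∂(Measure.pi fun _ : ι => μ) = 0 := by
      refine integral_eq_zero_of_ae (Eventually.of_forall fun x => ?_)
      by_cases hx : x ∈ tsupport Ψ
      · have hQx : Q x ∉ primePowBall K (k : ℤ) := fun h =>
          hN (primePowBall_antitone (by exact_mod_cast hk) h) ⟨x, hx, rfl⟩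
        simp only [Set.indicator_of_notMem hQx, mul_zero, Pi.zero_apply]
      · simp only [image_eq_zero_of_notMem_tsupport hx, zero_mul, Pi.zero_apply]
    rw [hint, mul_zero]
  have hconst : Tendsto (fun k : ℕ => (selfDualConst μ d : ℂ) * (μ.real (primePowBall K k) : ℂ)⁻¹ *
      ∫ x, Ψ x * (primePowBall K (k : ℤ)).indicator (fun _ => (1 : ℂ)) (Q x) ∂(Measure.pi fun _ : ι => μ)) atTop (𝓝 0) :=
    tendsto_const_nhds.congr' (eventually_atTop.2 ⟨N, fun k hk => (hzero k hk).symm⟩)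
  exact tendsto_nhds_unique hlim hconst

/-! ## §4 The scaling law at the vertex -/

/-- **THE SCALING LAW AT THE VERTEX**: for the boxes `B_n = (𝔭^n)^ι`,
`∫_β ∫_x 1_{B_{n+1}}(x)·ψ(β Q x) dμ^ι dμ = (q^{−card ι} · q²) · ∫_β ∫_x 1_{B_n}(x)·ψ(β Q x) dμ^ι dμ` — substitute `x = ϖ·u` (module `q^{−card ι}`,
`Q(ϖu) = ϖ² Q(u)`), then `β = ϖ^{−2} β′` (module `q²`).  With `3 ≤ card ι` the factor is `< 1`: the null-cone measure of `B_n` decays geometrically, so the vertex is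
NOT an atom. [cite: Weil1965, Chap. I n° 2 Lemme 3, p. 7] [cite: KudlaRallis1994, §5 (5.3)–(5.6)] -/
theorem nullConeIntegral_indicator_piPrimePowBall_succ (Q : QuadraticForm K (ι → K)) (n : ℤ) :
    ∫ β, ∫ x, (piPrimePowBall K ι (n + 1)).indicator (fun _ => (1 : ℂ)) x * ((ψ (β * Q x) : Circle) : ℂ) ∂(Measure.pi fun _ : ι => μ) ∂μ =
      ((((residueFieldCard K : ℝ≥0)⁻¹ ^ Fintype.card ι * (residueFieldCard K : ℝ≥0) ^ 2 : ℝ≥0) : ℝ) : ℂ) *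
        ∫ β, ∫ x, (piPrimePowBall K ι n).indicator (fun _ => (1 : ℂ)) x * ((ψ (β * Q x) : Circle) : ℂ) ∂(Measure.pi fun _ : ι => μ) ∂μ := by
  obtain ⟨ϖ, hϖ0, hϖ⟩ := exists_normAbs_eq_inv (F := K)
  have hq0 : (residueFieldCard K : ℝ≥0) ≠ 0 := Nat.cast_ne_zero.2 (residueFieldCard_ne_zero K)
  -- the homothety `u ↦ ϖ u` and its module
  set e : (ι → K) ≃ₗ[K] (ι → K) := LinearEquiv.smulOfNeZero K (ι → K) ϖ hϖ0 with he
  have heap : ∀ u : ι → K, e u = ϖ • u := fun u => rfl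
  have hdet : LinearMap.det (e : (ι → K) →ₗ[K] (ι → K)) = ϖ ^ Fintype.card ι := by
    have h1 : (e : (ι → K) →ₗ[K] (ι → K)) = ϖ • LinearMap.id := by
      apply LinearMap.ext; intro u; rfl
    rw [h1, LinearMap.det_smul, LinearMap.det_id, mul_one, Module.finrank_fintype_fun_eq_card]
  have hmod : normAbs K (LinearMap.det (e : (ι → K) →ₗ[K] (ι → K))) = (residueFieldCard K : ℝ≥0)⁻¹ ^ Fintype.card ι := by
    rw [hdet, map_pow, hϖ]
  -- inner substitution, for every `β`
  have hinner : ∀ β : K,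
      ∫ x, (piPrimePowBall K ι (n + 1)).indicator (fun _ => (1 : ℂ)) x * ((ψ (β * Q x) : Circle) : ℂ) ∂(Measure.pi fun _ : ι => μ) =
      (((residueFieldCard K : ℝ≥0)⁻¹ ^ Fintype.card ι : ℝ≥0) : ℝ) •
        ∫ u, (piPrimePowBall K ι n).indicator (fun _ => (1 : ℂ)) u * ((ψ ((ϖ * ϖ * β) * Q u) : Circle) : ℂ) ∂(Measure.pi fun _ : ι => μ) := by
    intro β
    have h := integral_comp_linearEquiv μ e
      (fun x => (piPrimePowBall K ι (n + 1)).indicator (fun _ => (1 : ℂ)) x * ((ψ (β * Q x) : Circle) : ℂ))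
    rw [map_inv₀, hmod] at h
    -- `h : ∫ φ(e u) du = (q^{-r})⁻¹ • ∫ φ`; invert the scalar
    have hc0 : (((residueFieldCard K : ℝ≥0)⁻¹ ^ Fintype.card ι : ℝ≥0) : ℝ) ≠ 0 := by
      exact_mod_cast pow_ne_zero _ (inv_ne_zero hq0)
    have h' : ∫ x, (piPrimePowBall K ι (n + 1)).indicator (fun _ => (1 : ℂ)) x * ((ψ (β * Q x) : Circle) : ℂ) ∂(Measure.pi fun _ : ι => μ) =
        (((residueFieldCard K : ℝ≥0)⁻¹ ^ Fintype.card ι : ℝ≥0) : ℝ) •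
          ∫ u, (piPrimePowBall K ι (n + 1)).indicator (fun _ => (1 : ℂ)) (e u) * ((ψ (β * Q (e u)) : Circle) : ℂ) ∂(Measure.pi fun _ : ι => μ) := by
      rw [h, smul_smul, NNReal.coe_inv, mul_inv_cancel₀ hc0, one_smul]
    rw [h']
    congr 1
    refine integral_congr_ae (Eventually.of_forall fun u => ?_)
    dsimp only
    -- `ϖ u ∈ B_{n+1} ↔ u ∈ B_n` and `Q(ϖ u) = ϖ² Q(u)`
    have hmem : (e u ∈ piPrimePowBall K ι (n + 1)) ↔ u ∈ piPrimePowBall K ι n := by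
      rw [heap, smul_mem_piPrimePowBall_iff (k := 1) (by rw [hϖ, zpow_one]), add_sub_cancel_right]
    have hQ : Q (e u) = ϖ * ϖ * Q u := by rw [heap, QuadraticMap.map_smul, smul_eq_mul]
    rw [hQ, show β * (ϖ * ϖ * Q u) = ϖ * ϖ * β * Q u by ring]
    by_cases hu : u ∈ piPrimePowBall K ι n
    · rw [Set.indicator_of_mem (hmem.2 hu), Set.indicator_of_mem hu]
    · rw [Set.indicator_of_notMem (fun h => hu (hmem.1 h)), Set.indicator_of_notMem hu]
  -- outer substitution `β ↦ ϖ² β`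
  have hϖ2 : ϖ * ϖ ≠ 0 := mul_ne_zero hϖ0 hϖ0
  have houter := integral_comp_mul_left μ hϖ2
    (fun β => ∫ u, (piPrimePowBall K ι n).indicator (fun _ => (1 : ℂ)) u * ((ψ (β * Q u) : Circle) : ℂ) ∂(Measure.pi fun _ : ι => μ))
  have hmod2 : normAbs K (ϖ * ϖ)⁻¹ = (residueFieldCard K : ℝ≥0) ^ 2 := by
    rw [map_inv₀, map_mul, hϖ, ← sq, inv_pow, inv_inv]
  rw [hmod2] at houter
  have hI : (fun β : K => ∫ x, (piPrimePowBall K ι (n + 1)).indicator (fun _ => (1 : ℂ)) x * ((ψ (β * Q x) : Circle) : ℂ) ∂(Measure.pi fun _ : ι => μ)) =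
      fun β => (((residueFieldCard K : ℝ≥0)⁻¹ ^ Fintype.card ι : ℝ≥0) : ℝ) •
        ∫ u, (piPrimePowBall K ι n).indicator (fun _ => (1 : ℂ)) u * ((ψ ((ϖ * ϖ * β) * Q u) : Circle) : ℂ) ∂(Measure.pi fun _ : ι => μ) :=
    funext hinner
  rw [hI, integral_smul, houter, smul_smul, ← NNReal.coe_mul, Complex.real_smul]

/-! ## §5 Uniform approximation of continuous test functions by real Schwartz–Bruhat functions (one factor; port of ★ SplitPlace's lemma) -/

omit [MeasurableSpace K] [BorelSpace K] in
/-- **UNIFORM APPROXIMATION BY LOCALLY CONSTANT FUNCTIONS**: a compactly supported continuous real `g` on `K^ι` vanishing off the box `(𝔭^{n₀})^ι` is, for every `ε > 0`,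
within `ε` of a LOCALLY CONSTANT real `Φ` vanishing off the same box (the values of `g` at chosen points of the level-`M` cosets, `M` fine enough — uniform continuity
through a finite subcover of the compact box; one-factor port of ★ `Weil1965.SplitPlace.exists_locallyConstant_approx`). [cite: Rudin1987, Ch. 2, Thm. 2.14] -/
theorem exists_isLocallyConstant_approx (g : C_c((ι → K), ℝ)) {n₀ : ℤ} (hn₀ : ∀ z, z ∉ piPrimePowBall K ι n₀ → g z = 0) {ε : ℝ} (hε : 0 < ε) :
    ∃ Φ : (ι → K) → ℝ, IsLocallyConstant Φ ∧ (∀ z, z ∉ piPrimePowBall K ι n₀ → Φ z = 0) ∧ ∀ z, |g z - Φ z| ≤ ε := by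
  classical
  set B := piPrimePowBall K ι n₀ with hB
  have hBc : IsCompact B := isCompact_piPrimePowBall n₀
  -- local oscillation control
  have hloc : ∀ z : ι → K, ∃ m : ℕ, ∀ w ∈ z +ᵥ piPrimePowBall K ι (m : ℤ), |g w - g z| < ε / 2 := by
    intro z
    have h1 : {w | |g w - g z| < ε / 2} ∈ 𝓝 z := by
      have hc : Continuous fun w => |g w - g z| := (g.continuous.sub continuous_const).abs
      exact hc.isOpen_preimage _ isOpen_Iio |>.mem_nhds (by simp [hε])
    have h2 : (fun t => z + t) ⁻¹' {w | |g w - g z| < ε / 2} ∈ 𝓝 (0 : ι → K) :=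
      (continuous_const.add continuous_id).continuousAt.preimage_mem_nhds (by simpa using h1)
    obtain ⟨m, hm⟩ := exists_piPrimePowBall_subset_of_mem_nhds_zero h2
    refine ⟨m, fun w hw => ?_⟩
    obtain ⟨t, ht, rfl⟩ := Set.mem_vadd_set.1 hw
    exact hm ht
  choose m hm using hloc
  have hU : ∀ z ∈ B, z +ᵥ piPrimePowBall K ι (m z : ℤ) ∈ 𝓝 z := fun z _ =>
    ((isOpen_piPrimePowBall _).vadd z).mem_nhds (self_mem_vadd_piPrimePowBall _ z)
  obtain ⟨S, hSB, hS⟩ := hBc.elim_nhds_subcover (fun z => z +ᵥ piPrimePowBall K ι (m z : ℤ)) hU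
  -- a common fine level `M ≥ n₀`
  set M : ℤ := max n₀ (S.sup m : ℕ) with hM
  have hMn : n₀ ≤ M := le_max_left _ _
  have hMz : ∀ z ∈ S, (m z : ℤ) ≤ M := fun z hz => (Int.ofNat_le.2 (Finset.le_sup hz)).trans (le_max_right _ _)
  -- the approximant: value of `g` at a chosen point of the level-`M` coset
  set C : (ι → K) → Set (ι → K) := fun z => z +ᵥ piPrimePowBall K ι M with hC
  have hzC : ∀ z, z ∈ C z := fun z => self_mem_vadd_piPrimePowBall M z
  have hCne : ∀ z, (C z).Nonempty := fun z => ⟨z, hzC z⟩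
  set Φ : (ι → K) → ℝ := fun z => B.indicator (fun z => g (hCne z).some) z with hΦ
  have hCmem : ∀ z, (hCne z).some ∈ C z := fun z => (hCne z).some_mem
  -- `B` is saturated by level-`M` cosets
  have hBsat : ∀ z ∈ B, C z ⊆ B := by
    intro z hz u hu
    rw [hC, mem_vadd_piPrimePowBall_iff] at hu
    have e : u = z + (u - z) := by abel
    rw [e]
    exact add_mem_piPrimePowBall hz (piPrimePowBall_antitone hMn hu)
  have hsome : ∀ (s t : Set (ι → K)) (hs : s.Nonempty) (ht : t.Nonempty), s = t → hs.some = ht.some := by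
    rintro s t hs ht rfl; rfl
  refine ⟨Φ, ?_, fun z hz => by rw [hΦ]; exact Set.indicator_of_notMem hz _, fun z => ?_⟩
  · -- locally constant: constant on every level-`M` coset
    rw [IsLocallyConstant.iff_exists_open]
    intro z
    refine ⟨C z, (isOpen_piPrimePowBall _).vadd z, hzC z, fun w hw => ?_⟩
    have hCw : C w = C z := vadd_piPrimePowBall_eq_of_mem hw
    have hrep : (hCne w).some = (hCne z).some := hsome _ _ _ _ hCw
    by_cases hzB : z ∈ B
    · have hwB : w ∈ B := hBsat z hzB hw
      simp only [hΦ, Set.indicator_of_mem hzB, Set.indicator_of_mem hwB, hrep]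
    · have hwB : w ∉ B := fun hwB => hzB (hBsat w hwB (hCw ▸ hzC z))
      simp only [hΦ, Set.indicator_of_notMem hzB, Set.indicator_of_notMem hwB]
  · -- the error estimate
    by_cases hz : z ∈ B
    · simp only [hΦ, Set.indicator_of_mem hz]
      obtain ⟨a, ha, hza⟩ := Set.mem_iUnion₂.1 (hS hz)
      have h1 : |g z - g a| < ε / 2 := hm a z hza
      -- the chosen representative of `C z` lies in `a + (𝔭^{m a})^ι` as well
      have hrepa : (hCne z).some ∈ a +ᵥ piPrimePowBall K ι (m a : ℤ) := by
        have hw : (hCne z).some - z ∈ piPrimePowBall K ι M := mem_vadd_piPrimePowBall_iff.1 (hCmem z)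
        rw [mem_vadd_piPrimePowBall_iff] at hza ⊢
        have e : (hCne z).some - a = ((hCne z).some - z) + (z - a) := by abel
        rw [e]
        exact add_mem_piPrimePowBall (piPrimePowBall_antitone (hMz a ha) hw) hza
      have h2 : |g (hCne z).some - g a| < ε / 2 := hm a _ hrepa
      rw [abs_sub_comm] at h2
      calc |g z - g (hCne z).some| = |(g z - g a) + (g a - g (hCne z).some)| := by ring_nf
        _ ≤ |g z - g a| + |g a - g (hCne z).some| := abs_add_le _ _
        _ ≤ ε := by linarith
    · rw [hn₀ z hz, hΦ]
      simp only [Set.indicator_of_notMem hz, sub_zero, abs_zero]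
      exact hε.le

end Summit.HodgeConjecture.HodgeConjecture.Cruxes.HLiu418.K2LiuNullConeFunctional

end
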